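import Summits.BirchSwinnertonDyer.Rank1Residual.Additive.CensusX42ValConverse
import Summits.BirchSwinnertonDyer.Rank1Residual.Additive.X3GordBranchPAdicGrossZagierIff
import HarnessLib

/-!
# Census relation X4-2 at WINDOW grade, VI: the remaining loops — `BSD(E,p)` ⟺ the typed WINDOW relation
# for every (B)-datum on p01's odd-branch / `p = 3` / X3♯(G-ord) IMC-version rows (cell `b2b-bsdres`,
# census cell `bsd-formula-census`, seat `b2b-bsdres-census-ctyper1` = conjecture-typer 1, gen 6;
# sibling of `CensusX42ValConverse.lean` §3)

HONEST FRAMING (cell `b2b-bsdres`, run/shared/lean/b2b/bsd-rank1-residual/, verbatim in every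
file): the goal of the cell is to DELETE the COMBINATION-SHAPED residual classes of the
Birch–Swinnerton-Dyer formula for ALL analytic-rank `≤ 1` elliptic curves over `ℚ` — "full BSD
formula for every rank `≤ 1` curve in class `C`" assembled STRICTLY from published theorems — so
that the rank-`≤ 1` remainder becomes exactly the CONSTRUCTION-SHAPED classes, which are TYPED
(missing-input `Prop`s), NOT attempted. This is not "finishing BSD". Census cell
(bsd-formula-census): research instrumentation; census output = EVIDENCE / conjecture items, never a
Literature fact; labels / RESIDUAL-MAP marks UNCHANGED (O7-ord OPEN; X3♯ / X4♯ CONSTRUCTION-SHAPED);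
nothing booked. THEOREMS ONLY (no definition, no named fact); Kato / Wuthrich halves `hK` / `hWu`,
Delbourgo 2002 `hDel` / `hDel3`, modularity `hmod` / `hmodD`, Gross–Zagier I.(7.3) `hGZ`, GZK `hGZK`
enter as HYPOTHESES; the typed LOWER divisibilities (`ChiBranchLowerDivisibility[Odd]At`, p01 / p07,
`@[conjecture]`), the Schneider rider `hSall` and the census relation `CensusX42.ValRelationAt`
(`@[conjecture]`, EVIDENCE) are HYPOTHESES — iff statements between typed predicates, nothing about any
curve asserted.

## What

`CensusX42ValConverse.lean` §3 closed p01's even-branch (G-ord) loop and the (M) loop at WINDOW grade.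
This file does the same, by the same two lines (p01's loop `.mp` + the pointwise converse
`valRelationAt_of_schneider_of_branchPAdicGrossZagier`; p01's forward class theorem + the bridge
`branchPAdicGrossZagier[Odd]At_of_valRelationAt`), for the remaining IMC-version loops of
`BranchPAdicGrossZagierIff.lean` (n1011-p01) and `X3GordBranchPAdicGrossZagierIff.lean` (n1011-p01):

* `ClassX4Gord.bsdp_iff_forall_censusX42Val_of_chiBranchLowerOdd_of_katoHalf` (`p ≡ 3 (mod 4)`, `p ≥ 7`);
* `ClassX4Gord.bsdp_three_iff_forall_censusX42Val_of_chiBranchLowerOdd_of_katoHalf` (`p = 3`);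
* `ClassX3Gord.bsdp_iff_forall_censusX42Val_of_chiBranchLower_of_wuthrichHalf` (`p ≡ 1 (mod 4)`);
* `ClassX3Gord.bsdp_iff_forall_censusX42Val_of_chiBranchLowerOdd_of_wuthrichHalf` (`p ≡ 3 (mod 4)`, `p ≥ 7`);
* `ClassX3Gord.bsdp_three_iff_forall_censusX42Val_of_chiBranchLowerOdd_of_wuthrichHalf` (`p = 3`);
* the three CAPSTONES of `CongruentPartnerBranchPAdicGrossZagierIff.lean` §3 (p01: `hdiv` and `hSall`
  DISCHARGED by the index-`b` unit coefficient + budget and the weak certificate `[T¹](ϖ·B) ≠ 0`) at window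
  grade: `ClassX4Gord.bsdp[_three]_iff_forall_censusX42Val_of_katoHalf_of_coeffCert_of_budget[_odd]`.

On each such row, GIVEN the IMC pieces and the rider: `BSD(E,p) ⟺ ∀ Dh, LeadingTermClauses → ValRelationAt W p Dh`
— the census's valuations-only WINDOW certificate measures exactly the kernel's open rank-one content.
EVIDENCE-conditional; nothing booked.

References: K. Kato, Astérisque 295 (2004) Thm. 17.4 (3) [Kato2004Asterisque]; C. Wuthrich, Doc. Math.
19 (2014) Thm. 16 [Wuthrich2014]; D. Delbourgo, J. Number Theory 95 (2002) Thm. (A), (B) [Delbourgo2002];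
B. Gross, D. Zagier, Invent. Math. 84 (1986) Thm. I.(7.3) [GrossZagier1986]; B. Mazur, J. Tate,
J. Teitelbaum, Invent. Math. 84 (1986) §I.13 [MazurTateTeitelbaum1986Invent]; R. L. Miller, LMS J.
Comput. Math. 14 (2011) Def. 1.1 [Miller2011LMS].
-/

set_option autoImplicit false

noncomputable section

open scoped Classical MatrixGroups ModularForm NumberField

open CongruenceSubgroup WeierstrassCurve NumberField Literature.NumberTheory.EllipticCurves
  Literature.NumberTheory.EllipticCurves.ModularForms
  Literature.NumberTheory.EllipticCurves.Rank1Residual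
  Literature.NumberTheory.EllipticCurves.Rank1Residual.Typed
  Literature.NumberTheory.EllipticCurves.Delbourgo2002
  Literature.NumberTheory.GaloisRepresentations
  Literature.Barriers.BirchSwinnertonDyer
  IsDedekindDomain

namespace Summit.BirchSwinnertonDyer.Rank1Residual.Additive

open CensusX42

section OddP

variable {W : WeierstrassCurve ℚ} [W.IsElliptic] [W.IsGloballyMinimal] {p : ℕ} [hp : Fact p.Prime]

/-- **X4♯(G-ord) ∩ `I₀*` ∩ {`ρ̄` onto}, `p ≡ 3 (mod 4)`, `p ≥ 7`, non-anomalous, `r_an = 1`:** GIVEN the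
odd-branch IMC pieces (p07's typed odd LOWER `hdiv` + Kato's half), Delbourgo 2002 (A)+(B), modularity,
GZ, GZK and the rider `hSall`: `BSD(E,p) ⟺ ∀ Dh, LeadingTermClauses → ValRelationAt W p Dh`.
[cite: Kato2004Asterisque, Thm. 17.4 (3) (p. 273)] [cite: Delbourgo2002, Theorem (A), (B) (p. 40)]
[cite: GrossZagier1986, Thm. I.(7.3)] [cite: Miller2011LMS, Def. 1.1] -/
theorem ClassX4Gord.bsdp_iff_forall_censusX42Val_of_chiBranchLowerOdd_of_katoHalf
    (hDel : Delbourgo2002.mainTheorem)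
    (hK : Wuthrich2014.kato_halfEigenCharIdeal_dvd_cyclotomicPrime_of_surjective)
    (hGZ : GrossZagier1986_thm_I_7_3) (hmod : hasEntireLFunction_rat)
    (hmodD : nonempty_modularParametrizationData) (hGZK : rank_eq_analyticRank_of_analyticRank_le_one)
    (hX : ClassX4Gord W p) (he : semistabilityIndex W p = 2) (hp4 : p % 4 = 3) (hp5 : 5 ≤ p)
    (hna : ReductionNonAnomalous W p) (hsurj : Surj W p) (hr : W.analyticRank = 1)
    (hdiv : ChiBranchLowerDivisibilityOddAt W p)
    (hSall : ∀ Dh : PAdicHeightData W p, LeadingTermClauses W p Dh → SchneiderConjecture Dh) :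
    BSDp W p ↔ ∀ Dh : PAdicHeightData W p, LeadingTermClauses W p Dh → ValRelationAt W p Dh := by
  have hcm := hX.not_hasCM_of_surj_of_five_le he hp5 hsurj
  refine ⟨fun hbsd Dh hB ↦ ?_, fun hrel ↦ ?_⟩
  · have hGZo := (hX.bsdp_iff_forall_branchPAdicGrossZagierOddAt_of_chiBranchLowerOdd_of_katoHalf hDel hK
      hmod hmodD hGZK he hp4 hp5 hcm hna hsurj hr hdiv hSall).mp hbsd
    exact valRelationAt_of_schneider_of_branchPAdicGrossZagier hGZ hGZK hmod hX.typeGOrd hr (hSall Dh hB)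
      (fun h1 ↦ absurd h1 (by omega)) (fun _ ↦ hGZo Dh hB)
  · exact hX.bsdp_rankOne_of_chiBranchLowerOdd_of_katoHalf_of_branchPAdicGrossZagierOdd hDel hK hmod hmodD
      hGZK he hp4 hp5 hcm hna hsurj hr hdiv fun Dh hB ↦
        ⟨hSall Dh hB, branchPAdicGrossZagierOddAt_of_valRelationAt hGZ hGZK W hX.addv.2 hr Dh (hrel Dh hB)⟩

/-- **X3♯(G-ord) ∩ `I₀*`, `p ≡ 1 (mod 4)`, non-CM, non-anomalous, `r_an = 1`:** GIVEN the even-branch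
IMC pieces (typed LOWER `hdiv` + Wuthrich's half `hWu`), Delbourgo 2002 (A)+(B), modularity, GZ, GZK and
the rider `hSall`: `BSD(E,p) ⟺ ∀ Dh, LeadingTermClauses → ValRelationAt W p Dh`.
[cite: Wuthrich2014, Thm. 16 (p. 397)] [cite: Delbourgo2002, Theorem (A), (B) (p. 40)]
[cite: GrossZagier1986, Thm. I.(7.3)] [cite: Miller2011LMS, Def. 1.1] -/
theorem ClassX3Gord.bsdp_iff_forall_censusX42Val_of_chiBranchLower_of_wuthrichHalf
    (hDel : Delbourgo2002.mainTheorem) (hWu : Wuthrich2014.thm16_halfEigenCharIdeal_dvd_cyclotomicPrime)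
    (hGZ : GrossZagier1986_thm_I_7_3) (hmod : hasEntireLFunction_rat)
    (hmodD : nonempty_modularParametrizationData) (hGZK : rank_eq_analyticRank_of_analyticRank_le_one)
    (hX : ClassX3Gord W p) (he : semistabilityIndex W p = 2) (hp4 : p % 4 = 1) (hcm : ¬ W.HasCM)
    (hna : ReductionNonAnomalous W p) (hr : W.analyticRank = 1) (hdiv : ChiBranchLowerDivisibilityAt W p)
    (hSall : ∀ Dh : PAdicHeightData W p, LeadingTermClauses W p Dh → SchneiderConjecture Dh) :
    BSDp W p ↔ ∀ Dh : PAdicHeightData W p, LeadingTermClauses W p Dh → ValRelationAt W p Dh := by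
  refine ⟨fun hbsd Dh hB ↦ ?_, fun hrel ↦ ?_⟩
  · have hGZe := (hX.bsdp_iff_forall_branchPAdicGrossZagierAt_of_chiBranchLower_of_wuthrichHalf hDel hWu
      hmod hmodD hGZK he hp4 hcm hna hr hdiv hSall).mp hbsd
    exact valRelationAt_of_schneider_of_branchPAdicGrossZagier hGZ hGZK hmod hX.typeGOrd hr (hSall Dh hB)
      (fun _ ↦ hGZe Dh hB) (fun h3 ↦ absurd h3 (by omega))
  · exact hX.bsdp_rankOne_of_chiBranchLower_of_wuthrichHalf_of_branchPAdicGrossZagier hDel hWu hmod hmodD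
      hGZK he hp4 hcm hna hr hdiv fun Dh hB ↦
        ⟨hSall Dh hB, branchPAdicGrossZagierAt_of_valRelationAt hGZ hGZK W hX.addv hr Dh (hrel Dh hB)⟩

/-- **X3♯(G-ord) ∩ `I₀*`, `p ≡ 3 (mod 4)`, `p ≥ 7`, non-CM, non-anomalous, `r_an = 1`:** GIVEN the
odd-branch IMC pieces (typed odd LOWER + Wuthrich's half), Delbourgo 2002 (A)+(B), modularity, GZ, GZK
and the rider: `BSD(E,p) ⟺ ∀ Dh, LeadingTermClauses → ValRelationAt W p Dh`.
[cite: Wuthrich2014, Thm. 16 (p. 397)] [cite: Delbourgo2002, Theorem (A), (B) (p. 40)]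
[cite: GrossZagier1986, Thm. I.(7.3)] [cite: Miller2011LMS, Def. 1.1] -/
theorem ClassX3Gord.bsdp_iff_forall_censusX42Val_of_chiBranchLowerOdd_of_wuthrichHalf
    (hDel : Delbourgo2002.mainTheorem) (hWu : Wuthrich2014.thm16_halfEigenCharIdeal_dvd_cyclotomicPrime)
    (hGZ : GrossZagier1986_thm_I_7_3) (hmod : hasEntireLFunction_rat)
    (hmodD : nonempty_modularParametrizationData) (hGZK : rank_eq_analyticRank_of_analyticRank_le_one)
    (hX : ClassX3Gord W p) (he : semistabilityIndex W p = 2) (hp4 : p % 4 = 3) (hp5 : 5 ≤ p)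
    (hcm : ¬ W.HasCM) (hna : ReductionNonAnomalous W p) (hr : W.analyticRank = 1)
    (hdiv : ChiBranchLowerDivisibilityOddAt W p)
    (hSall : ∀ Dh : PAdicHeightData W p, LeadingTermClauses W p Dh → SchneiderConjecture Dh) :
    BSDp W p ↔ ∀ Dh : PAdicHeightData W p, LeadingTermClauses W p Dh → ValRelationAt W p Dh := by
  refine ⟨fun hbsd Dh hB ↦ ?_, fun hrel ↦ ?_⟩
  · have hGZo := (hX.bsdp_iff_forall_branchPAdicGrossZagierOddAt_of_chiBranchLowerOdd_of_wuthrichHalf hDel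
      hWu hmod hmodD hGZK he hp4 hp5 hcm hna hr hdiv hSall).mp hbsd
    exact valRelationAt_of_schneider_of_branchPAdicGrossZagier hGZ hGZK hmod hX.typeGOrd hr (hSall Dh hB)
      (fun h1 ↦ absurd h1 (by omega)) (fun _ ↦ hGZo Dh hB)
  · exact hX.bsdp_rankOne_of_chiBranchLowerOdd_of_wuthrichHalf_of_branchPAdicGrossZagierOdd hDel hWu hmod
      hmodD hGZK he hp4 hp5 hcm hna hr hdiv fun Dh hB ↦
        ⟨hSall Dh hB, branchPAdicGrossZagierOddAt_of_valRelationAt hGZ hGZK W hX.addv hr Dh (hrel Dh hB)⟩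

/-- **CAPSTONE at WINDOW grade, even branch** (p01's
`ClassX4Gord.bsdp_iff_forall_branchPAdicGrossZagierAt_of_katoHalf_of_coeffCert_of_budget` read through
`CensusX42ValConverse` §3): X4♯(G-ord) ∩ `I₀*` ∩ {`ρ̄` onto}, `p ≡ 1 (mod 4)`, non-anomalous, `r_an = 1`;
GIVEN Kato's half, Delbourgo (A)+(B), modularity, GZ, GZK, the index-`b` unit coefficient with the budget
(K-OUT ⟹ the typed LOWER) and the weak certificate `[T¹](ϖ·B) ≠ 0` (⟹ the rider):
`BSD(E,p) ⟺ ∀ Dh, LeadingTermClauses → ValRelationAt W p Dh`. [cite: Kato2004Asterisque, Thm. 17.4 (3) (p. 273)]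
[cite: Delbourgo2002, Theorem (A), (B), Example (p. 40)] [cite: GrossZagier1986, Thm. I.(7.3)] [cite: Miller2011LMS, Def. 1.1] -/
theorem ClassX4Gord.bsdp_iff_forall_censusX42Val_of_katoHalf_of_coeffCert_of_budget
    (hDel : Delbourgo2002.mainTheorem)
    (hK : Wuthrich2014.kato_halfEigenCharIdeal_dvd_cyclotomicPrime_of_surjective)
    (hGZ : GrossZagier1986_thm_I_7_3) (hmod : hasEntireLFunction_rat)
    (hmodD : nonempty_modularParametrizationData) (hGZK : rank_eq_analyticRank_of_analyticRank_le_one)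
    (hX : ClassX4Gord W p) (he : semistabilityIndex W p = 2) (hp4 : p % 4 = 1)
    (hna : ReductionNonAnomalous W p) (hsurj : Surj W p) (hr : W.analyticRank = 1)
    {b : ℕ} (hcert : BranchUnitCoeffAt W p b) (hbud : BudgetLeLambdaAt p W b)
    (hne : BranchCoeffOneNeZeroAt W p) :
    BSDp W p ↔ ∀ Dh : PAdicHeightData W p, LeadingTermClauses W p Dh → ValRelationAt W p Dh :=
  hX.bsdp_iff_forall_censusX42Val_of_chiBranchLower_of_katoHalf hDel hK hGZ hmod hmodD hGZK he hp4 hna hsurj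
    hr (hX.chiBranchLowerDivisibilityAt_of_katoHalf_of_coeffCert_of_budget hK he hsurj hcert hbud)
    (hX.forall_schneider_of_katoHalf_of_coeffOneNeZero hK hmodD hGZK he hsurj hr hne)

/-- **CAPSTONE at WINDOW grade, odd branch `p ≥ 7`** (p01's
`ClassX4Gord.bsdp_iff_forall_branchPAdicGrossZagierOddAt_of_katoHalf_of_coeffCert_of_budget`):
`BSD(E,p) ⟺ ∀ Dh, LeadingTermClauses → ValRelationAt W p Dh`. [cite: Kato2004Asterisque, Thm. 17.4 (3) (p. 273)]
[cite: Delbourgo2002, Theorem (A), (B), Example (p. 40)] [cite: GrossZagier1986, Thm. I.(7.3)] [cite: Miller2011LMS, Def. 1.1] -/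
theorem ClassX4Gord.bsdp_iff_forall_censusX42Val_of_katoHalf_of_coeffCert_of_budget_odd
    (hDel : Delbourgo2002.mainTheorem)
    (hK : Wuthrich2014.kato_halfEigenCharIdeal_dvd_cyclotomicPrime_of_surjective)
    (hGZ : GrossZagier1986_thm_I_7_3) (hmod : hasEntireLFunction_rat)
    (hmodD : nonempty_modularParametrizationData) (hGZK : rank_eq_analyticRank_of_analyticRank_le_one)
    (hX : ClassX4Gord W p) (he : semistabilityIndex W p = 2) (hp4 : p % 4 = 3) (hp5 : 5 ≤ p)
    (hna : ReductionNonAnomalous W p) (hsurj : Surj W p) (hr : W.analyticRank = 1)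
    {b : ℕ} (hcert : BranchUnitCoeffAt W p b) (hbud : BudgetLeLambdaAt p W b)
    (hne : BranchCoeffOneNeZeroAt W p) :
    BSDp W p ↔ ∀ Dh : PAdicHeightData W p, LeadingTermClauses W p Dh → ValRelationAt W p Dh :=
  hX.bsdp_iff_forall_censusX42Val_of_chiBranchLowerOdd_of_katoHalf hDel hK hGZ hmod hmodD hGZK he hp4 hp5
    hna hsurj hr (hX.chiBranchLowerDivisibilityOddAt_of_katoHalf_of_coeffCert_of_budget hK he hsurj hcert hbud)
    (hX.forall_schneider_of_katoHalf_of_coeffOneNeZero hK hmodD hGZK he hsurj hr hne)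

end OddP

/-! ### `p = 3` -/

section Three

variable {W : WeierstrassCurve ℚ} [W.IsElliptic] [W.IsGloballyMinimal] [h3 : Fact (Nat.Prime 3)]

/-- **X4♯(G-ord) ∩ {`ρ̄_{E,3}` onto} at `p = 3`, non-CM, non-anomalous, `r_an = 1`:** GIVEN the odd-branch
IMC pieces (typed odd LOWER + Kato's half), Delbourgo 2002 at `p = 3` (`hDel3`), modularity, GZ, GZK and
the rider: `BSD(E,3) ⟺ ∀ Dh, LeadingTermClauses → ValRelationAt W 3 Dh`.
[cite: Kato2004Asterisque, Thm. 17.4 (3) (p. 273)] [cite: Delbourgo2002, Theorem (A), (B) (p. 40)]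
[cite: GrossZagier1986, Thm. I.(7.3)] [cite: Miller2011LMS, Def. 1.1] -/
theorem ClassX4Gord.bsdp_three_iff_forall_censusX42Val_of_chiBranchLowerOdd_of_katoHalf
    (hDel3 : Delbourgo2002.mainTheorem_three)
    (hK : Wuthrich2014.kato_halfEigenCharIdeal_dvd_cyclotomicPrime_of_surjective)
    (hGZ : GrossZagier1986_thm_I_7_3) (hmod : hasEntireLFunction_rat)
    (hmodD : nonempty_modularParametrizationData) (hGZK : rank_eq_analyticRank_of_analyticRank_le_one)
    (hX : ClassX4Gord W 3) (hcm : ¬ W.HasCM) (hna : ReductionNonAnomalous W 3) (hsurj : Surj W 3)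
    (hr : W.analyticRank = 1) (hdiv : ChiBranchLowerDivisibilityOddAt W 3)
    (hSall : ∀ Dh : PAdicHeightData W 3, LeadingTermClauses W 3 Dh → SchneiderConjecture Dh) :
    BSDp W 3 ↔ ∀ Dh : PAdicHeightData W 3, LeadingTermClauses W 3 Dh → ValRelationAt W 3 Dh := by
  refine ⟨fun hbsd Dh hB ↦ ?_, fun hrel ↦ ?_⟩
  · have hGZo := (hX.bsdp_three_iff_forall_branchPAdicGrossZagierOddAt_of_chiBranchLowerOdd_of_katoHalf
      hDel3 hK hmod hmodD hGZK hcm hna hsurj hr hdiv hSall).mp hbsd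
    exact valRelationAt_of_schneider_of_branchPAdicGrossZagier hGZ hGZK hmod hX.typeGOrd hr (hSall Dh hB)
      (fun h1 ↦ absurd h1 (by decide)) (fun _ ↦ hGZo Dh hB)
  · exact hX.bsdp_three_rankOne_of_chiBranchLowerOdd_of_katoHalf_of_branchPAdicGrossZagierOdd hDel3 hK
      hmod hmodD hGZK hcm hna hsurj hr hdiv fun Dh hB ↦
        ⟨hSall Dh hB, branchPAdicGrossZagierOddAt_of_valRelationAt hGZ hGZK W hX.addv.2 hr Dh (hrel Dh hB)⟩

/-- **X3♯(G-ord) at `p = 3`, non-CM, non-anomalous, `r_an = 1`:** GIVEN the odd-branch IMC pieces (typed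
odd LOWER + Wuthrich's half), Delbourgo 2002 at `p = 3`, modularity, GZ, GZK and the rider:
`BSD(E,3) ⟺ ∀ Dh, LeadingTermClauses → ValRelationAt W 3 Dh`. [cite: Wuthrich2014, Thm. 16 (p. 397)]
[cite: Delbourgo2002, Theorem (A), (B) (p. 40)] [cite: GrossZagier1986, Thm. I.(7.3)] [cite: Miller2011LMS, Def. 1.1] -/
theorem ClassX3Gord.bsdp_three_iff_forall_censusX42Val_of_chiBranchLowerOdd_of_wuthrichHalf
    (hDel3 : Delbourgo2002.mainTheorem_three)
    (hWu : Wuthrich2014.thm16_halfEigenCharIdeal_dvd_cyclotomicPrime)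
    (hGZ : GrossZagier1986_thm_I_7_3) (hmod : hasEntireLFunction_rat)
    (hmodD : nonempty_modularParametrizationData) (hGZK : rank_eq_analyticRank_of_analyticRank_le_one)
    (hX : ClassX3Gord W 3) (hcm : ¬ W.HasCM) (hna : ReductionNonAnomalous W 3) (hr : W.analyticRank = 1)
    (hdiv : ChiBranchLowerDivisibilityOddAt W 3)
    (hSall : ∀ Dh : PAdicHeightData W 3, LeadingTermClauses W 3 Dh → SchneiderConjecture Dh) :
    BSDp W 3 ↔ ∀ Dh : PAdicHeightData W 3, LeadingTermClauses W 3 Dh → ValRelationAt W 3 Dh := by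
  refine ⟨fun hbsd Dh hB ↦ ?_, fun hrel ↦ ?_⟩
  · have hGZo := (hX.bsdp_three_iff_forall_branchPAdicGrossZagierOddAt_of_chiBranchLowerOdd_of_wuthrichHalf
      hDel3 hWu hmod hmodD hGZK hcm hna hr hdiv hSall).mp hbsd
    exact valRelationAt_of_schneider_of_branchPAdicGrossZagier hGZ hGZK hmod hX.typeGOrd hr (hSall Dh hB)
      (fun h1 ↦ absurd h1 (by decide)) (fun _ ↦ hGZo Dh hB)
  · exact hX.bsdp_three_rankOne_of_chiBranchLowerOdd_of_wuthrichHalf_of_branchPAdicGrossZagierOdd hDel3 hWu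
      hmod hmodD hGZK hcm hna hr hdiv fun Dh hB ↦
        ⟨hSall Dh hB, branchPAdicGrossZagierOddAt_of_valRelationAt hGZ hGZK W hX.addv hr Dh (hrel Dh hB)⟩

/-- **CAPSTONE at WINDOW grade, `p = 3`** (p01's
`ClassX4Gord.bsdp_three_iff_forall_branchPAdicGrossZagierOddAt_of_katoHalf_of_coeffCert_of_budget`; `hcm`
stays a binder at `3`; `e_E(3) = 2` automatic): `BSD(E,3) ⟺ ∀ Dh, LeadingTermClauses → ValRelationAt W 3 Dh`.
[cite: Kato2004Asterisque, Thm. 17.4 (3) (p. 273)] [cite: Delbourgo2002, Theorem (A), (B) (p. 40)]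
[cite: GrossZagier1986, Thm. I.(7.3)] [cite: Miller2011LMS, Def. 1.1] -/
theorem ClassX4Gord.bsdp_three_iff_forall_censusX42Val_of_katoHalf_of_coeffCert_of_budget
    (hDel3 : Delbourgo2002.mainTheorem_three)
    (hK : Wuthrich2014.kato_halfEigenCharIdeal_dvd_cyclotomicPrime_of_surjective)
    (hGZ : GrossZagier1986_thm_I_7_3) (hmod : hasEntireLFunction_rat)
    (hmodD : nonempty_modularParametrizationData) (hGZK : rank_eq_analyticRank_of_analyticRank_le_one)
    (hX : ClassX4Gord W 3) (hcm : ¬ W.HasCM) (hna : ReductionNonAnomalous W 3) (hsurj : Surj W 3)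
    (hr : W.analyticRank = 1) {b : ℕ} (hcert : BranchUnitCoeffAt W 3 b) (hbud : BudgetLeLambdaAt 3 W b)
    (hne : BranchCoeffOneNeZeroAt W 3) :
    BSDp W 3 ↔ ∀ Dh : PAdicHeightData W 3, LeadingTermClauses W 3 Dh → ValRelationAt W 3 Dh :=
  have he : semistabilityIndex W 3 = 2 :=
    semistabilityIndex_eq_two_of_typeG_three W hX.typeGOrd.typeG hX.addv.2
  hX.bsdp_three_iff_forall_censusX42Val_of_chiBranchLowerOdd_of_katoHalf hDel3 hK hGZ hmod hmodD hGZK hcm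
    hna hsurj hr (hX.chiBranchLowerDivisibilityOddAt_of_katoHalf_of_coeffCert_of_budget hK he hsurj hcert hbud)
    (hX.forall_schneider_of_katoHalf_of_coeffOneNeZero hK hmodD hGZK he hsurj hr hne)

end Three

end Summit.BirchSwinnertonDyer.Rank1Residual.Additive

end
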